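import Summits.Schanuel.Schanuel.Theorems.RootDecomp1ELWTransport07

/-!
# RootDecomp1ELWTransport — lens 2, generation 39 «LW-PAIR NORM TRANSPORT CELL» (lane E-R18 (a)): S ITSELF on the class `InLWClass` (E-doubled moment curves over a dyadic 2-fold-hyper-Liouville T), engine `algebraicIndependent_lwPt` mod `hLW : LWMeasure` — continuation (RootDecomp1ELWTransport08): §6–§6b SEPARATION from the g35/g36/g37 classes

(lens-2 g39 `LWTransport.lean` [HOME/decomp-schanuel-lens-2/g39/ sha256 cff5d88d…e8f0, 2208 l; NODE L1907 / REQUEST L1908; critic VERDICT L1909 (CLEARED, E-R18 (a) cell credit, port GO)]; port by census-1 gen 17 as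
`RootDecomp1ELWTransport01`–`09` — see the PORT NOTE of part 01; `--supports stmt-Schanuel-31409`; rung 0.)
-/

noncomputable section

open Complex Polynomial
open Literature.NumberTheory.Transcendental (zlen zlen_nonneg zlen_add_le zlen_monomial_le zlen_sum_le
  zlen_mul_le zlen_pow_le)

namespace Summit.Schanuel.Schanuel.Theorems.RootDecomp1ELWTransport

open Summit.Schanuel.Schanuel.Theorems.RootDecomp1KHyper (SB SFset sb_of_algebraicIndependent LWMeasure
  exists_ball_eval_ne_zero exists_int_mul_eq_map mvaeval_int_map)
open Summit.Schanuel.Schanuel.Theorems.RootDecomp1KHyper.HyperCell (Ewt exC collPoly collPoly_ne_zero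
  exC_inj)
open NormDescent (P2)

variable {k : ℕ}

/-! ## §6  SEPARATION from the earlier lens-2 cells (g35 `InScaleClass`, g36 `InPointClass`)

The cell predicates of g35/g36 live in HOME files (not tree modules); they are COPIED VERBATIM into the
sub-namespace `Sep` so that the separation theorems below are self-contained and typed against the
same text.  In both classes every ratio `z i / z l` of two coordinates is ALGEBRAIC; for `z₄` the ratio
`z₄ 2 / z₄ 0 = T⋆` is transcendental (Liouville), so `z₄` lies in neither. -/

namespace Sep

/-- [g35 ScaleTransfer.lean l.76, verbatim] -/
def msize {D n : ℕ} (M : Fin D → Fin n → ℤ) : ℕ := ∑ i, ∑ j, (M i j).natAbs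

/-- [g35 ScaleTransfer.lean l.328, verbatim] -/
def HyperScaleApprox {D n : ℕ} (ω : Fin D → ℂ) (y : Fin n → ℂ) (ξ : ℂ) : Prop :=
  ∀ m : ℕ, ∃ (γ : ℂ) (M : Fin D → Fin n → ℤ), γ ≠ 0 ∧ (∀ j, γ * y j = ∑ i, (M i j : ℂ) * ω i) ∧
    ‖ξ - γ‖ < Real.exp (-Real.exp ((2 + (msize M : ℝ)) ^ m))

/-- [g35 ScaleTransfer.lean l.592, verbatim] -/
def InScaleClass {n : ℕ} (z : Fin n → ℂ) : Prop :=
  ∃ (D : ℕ) (ω : Fin D → ℂ) (y : Fin n → ℂ) (ξ : ℂ), (∀ i, IsAlgebraic ℚ (ω i)) ∧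
    LinearIndependent ℚ ω ∧ HyperScaleApprox ω y ξ ∧ z = fun j => ξ * y j

open Summit.Schanuel.Schanuel.Theorems.RootDecomp1KHyper.HyperCell (HyperLiouville) in
/-- [g36 PointTransfer.lean l.543, verbatim; `HyperLiouville` is the TREE constant
`RootDecomp1KHyper.HyperCell.HyperLiouville` (Hyper05)] -/
def InPointClass {n : ℕ} (z : Fin n → ℂ) : Prop :=
  ∃ (ρ : ℝ) (y : Fin n → ℂ), HyperLiouville ρ ∧ (∀ j, IsAlgebraic ℚ (y j)) ∧ LinearIndependent ℚ y ∧
    z = fun j => (ρ : ℂ) * y j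

end Sep

/-- `zStar 0 ≠ 0`. -/
theorem zStar_0_ne : zStar 0 ≠ 0 := by
  rw [zStar_0]; exact Complex.ofReal_ne_zero.mpr Tstar_pos.ne'

/-- `zStar 2 / zStar 0 = Tstar`. -/
theorem zStar_ratio : zStar 2 / zStar 0 = Tstar := by
  have h : (Tstar : ℂ) ≠ 0 := Complex.ofReal_ne_zero.mpr Tstar_pos.ne'
  rw [zStar_2, zStar_0, sq, mul_div_assoc, div_self h, mul_one]

/-- `IsAlgebraic ℚ (∑ i, (c i : ℂ) * ω i)`. -/
private theorem isAlgebraic_intCombination {D : ℕ} {ω : Fin D → ℂ} (hω : ∀ i, IsAlgebraic ℚ (ω i))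
    (c : Fin D → ℤ) : IsAlgebraic ℚ (∑ i, (c i : ℂ) * ω i) :=
  Finset.sum_induction _ (fun x => IsAlgebraic ℚ x) (fun _ _ ha hb => ha.add hb) isAlgebraic_zero
    fun i _ => (isAlgebraic_int (c i)).mul (hω i)

/-- **SEPARATION 1: `z₄ ∉` g36's point class** (there all coordinate ratios are algebraic). -/
theorem not_inPointClass_zStar : ¬ Sep.InPointClass zStar := by
  rintro ⟨ρ, y, -, hyalg, -, hz⟩
  have e0 : zStar 0 = ρ * y 0 := congrFun hz 0
  have e2 : zStar 2 = ρ * y 2 := congrFun hz 2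
  have hρ : (ρ : ℂ) ≠ 0 := fun h => zStar_0_ne (by rw [e0, h, zero_mul])
  have halg : IsAlgebraic ℚ (zStar 2 / zStar 0) := by
    rw [e2, e0, mul_div_mul_left _ _ hρ, div_eq_mul_inv]
    exact (hyalg 2).mul (hyalg 0).inv
  rw [zStar_ratio] at halg
  exact Tstar_transcendental halg

/-- **SEPARATION 2: `z₄ ∉` g35's scale class** (there `γ·y` is algebraic for the level-0 approximant
`γ ≠ 0`, so again all coordinate ratios are algebraic). -/
theorem not_inScaleClass_zStar : ¬ Sep.InScaleClass zStar := by
  rintro ⟨D, ω, y, ξ, hωalg, -, happ, hz⟩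
  obtain ⟨γ, M, hγ, hγy, -⟩ := happ 0
  have halgγ : ∀ j, IsAlgebraic ℚ (γ * y j) := fun j => by
    rw [hγy j]; exact isAlgebraic_intCombination hωalg _
  have e0 : zStar 0 = ξ * y 0 := congrFun hz 0
  have e2 : zStar 2 = ξ * y 2 := congrFun hz 2
  have hξ : ξ ≠ 0 := fun h => zStar_0_ne (by rw [e0, h, zero_mul])
  have halg : IsAlgebraic ℚ (zStar 2 / zStar 0) := by
    rw [e2, e0, mul_div_mul_left _ _ hξ, ← mul_div_mul_left (y 2) (y 0) hγ, div_eq_mul_inv]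
    exact (halgγ 2).mul (halgγ 0).inv
  rw [zStar_ratio] at halg
  exact Tstar_transcendental halg

/-! ## §6b  SEPARATION from g37's two-scale class `InTwoScaleClass`: `¬ CoveredTower T⋆`

`z₄ = (T⋆, iT⋆, T⋆², iT⋆²)` HAS g37's shape `(T, βT, σ, βσ)` (`β = i`, `σ = T⋆²`), so the separation is a
statement about the FIRST scale: g37 needs `T` to be a COVERED log-cube tower (a good rational approximant
at EVERY scale `X`, denominator in `[X, exp(4 log⁴ X)]`); the lacunary dyadic series `T⋆ = Σ 2^{−a_ν}` has,
just above each denominator `2^{a_ν}`, a window of scales with NO approximant better than `1/(2q²)`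
(the next term `2^{−a_{ν+1}}` is far below the window).  PROVED below. -/

namespace Sep

/-- [g37 TwoScale.lean l.276, verbatim] -/
def CoveredTower (ρ : ℝ) : Prop :=
  ∃ N₀ : ℕ, ∀ X : ℕ, N₀ ≤ X → ∃ r : ℚ, X ≤ r.den ∧
    Real.log r.den ≤ 4 * Real.log X ^ 4 ∧ |ρ - r| ≤ Real.exp (-(Real.log r.den ^ 3))

/-- [g37 TwoScale.lean l.249, verbatim] -/
def LogPowLiouville (p : ℕ) (ρ : ℝ) : Prop :=
  ∀ m : ℕ, ∃ r : ℚ, m ≤ r.den ∧ ρ ≠ r ∧ |ρ - r| < Real.exp (-((m : ℝ) * Real.log r.den ^ p))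

/-- [g37 TwoScale.lean l.1997, verbatim] -/
def InTwoScaleClass (z : Fin 4 → ℂ) : Prop :=
  ∃ (T σ : ℝ) (β : ℂ), CoveredTower T ∧ T ≠ 0 ∧ LogPowLiouville 19 σ ∧ IsAlgebraic ℚ β ∧
    β ∉ Set.range (algebraMap ℚ ℂ) ∧ z = ![(T : ℂ), β * T, (σ : ℂ), β * σ]

end Sep

/-- `4 * (a + 1) ≤ 2 ^ a` (for `{a : ℕ} (ha : 8 ≤ a)`). -/
private theorem four_mul_succ_le_two_pow {a : ℕ} (ha : 8 ≤ a) : 4 * (a + 1) ≤ 2 ^ a := by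
  induction a, ha using Nat.le_induction with
  | base => norm_num
  | succ n hn ih => rw [pow_succ]; omega

/-- `8 * (n + 1) ^ 4 + 2 ≤ 81 ^ (n + 1)` (for `(n : ℕ)`). -/
private theorem eight_pow_four_le (n : ℕ) : 8 * (n + 1) ^ 4 + 2 ≤ 81 ^ (n + 1) := by
  induction n with
  | zero => norm_num
  | succ n ih =>
      have h2 : n + 2 ≤ 2 * (n + 1) := by omega
      have h1 : (n + 2) ^ 4 ≤ 16 * (n + 1) ^ 4 :=
        calc (n + 2) ^ 4 ≤ (2 * (n + 1)) ^ 4 := Nat.pow_le_pow_left h2 4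
          _ = 16 * (n + 1) ^ 4 := by ring
      calc 8 * (n + 1 + 1) ^ 4 + 2 = 8 * (n + 2) ^ 4 + 2 := by ring_nf
        _ ≤ 8 * (16 * (n + 1) ^ 4) + 2 := by linarith
        _ ≤ 81 * (8 * (n + 1) ^ 4 + 2) := by linarith [Nat.zero_le ((n + 1) ^ 4)]
        _ ≤ 81 * 81 ^ (n + 1) := Nat.mul_le_mul_left _ ih
        _ = 81 ^ (n + 1 + 1) := by ring

/-- `8 * (a + 1) ^ 4 + 2 ≤ 3 ^ 2 ^ a` (for `{a : ℕ} (ha : 8 ≤ a)`). -/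
private theorem key_nat {a : ℕ} (ha : 8 ≤ a) : 8 * (a + 1) ^ 4 + 2 ≤ 3 ^ 2 ^ a :=
  calc 8 * (a + 1) ^ 4 + 2 ≤ 81 ^ (a + 1) := eight_pow_four_le a
    _ = 3 ^ (4 * (a + 1)) := by rw [pow_mul]; norm_num
    _ ≤ 3 ^ 2 ^ a := Nat.pow_le_pow_right (by norm_num) (four_mul_succ_le_two_pow ha)

/-- `aSeq 1 = 8`. -/
theorem aSeq_one : aSeq 1 = 8 := by decide

/-- `8 ≤ aSeq ν` (for `{ν : ℕ} (hν : 1 ≤ ν)`). -/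
theorem eight_le_aSeq {ν : ℕ} (hν : 1 ≤ ν) : 8 ≤ aSeq ν := by
  rw [← aSeq_one]; exact aSeq_strictMono.monotone hν

/-- `2 * 3 ^ 2 ^ aSeq ν ≤ aSeq (ν + 1)` (for `{ν : ℕ} (hν : 1 ≤ ν)`). -/
theorem two_mul_three_pow_le_aSeq_succ {ν : ℕ} (hν : 1 ≤ ν) : 2 * 3 ^ 2 ^ aSeq ν ≤ aSeq (ν + 1) := by
  rw [aSeq_succ]
  have h : 2 ^ aSeq ν ≤ 2 ^ (ν * aSeq ν) :=
    Nat.pow_le_pow_right (by norm_num) (Nat.le_mul_of_pos_left _ hν)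
  have h' : 3 ^ 2 ^ aSeq ν ≤ 3 ^ 2 ^ (ν * aSeq ν) := Nat.pow_le_pow_right (by norm_num) h
  omega

/-- `exp y ≤ 4^n` whenever `y ≤ n` (crude: `e ≤ 4`). -/
theorem exp_le_four_pow {y : ℝ} {n : ℕ} (h : y ≤ n) : Real.exp y ≤ (4 : ℝ) ^ n := by
  have he4 : Real.exp 1 ≤ 4 := by have := Real.exp_one_lt_d9; linarith
  calc Real.exp y ≤ Real.exp n := Real.exp_le_exp.mpr h
    _ = Real.exp 1 ^ n := (Real.exp_one_pow n).symm
    _ ≤ 4 ^ n := pow_le_pow_left₀ (Real.exp_pos _).le he4 n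

/-- two distinct rationals are `1/(den·den)` apart -/
theorem one_div_le_abs_sub_rat {r s : ℚ} (hrs : r ≠ s) :
    1 / ((r.den : ℝ) * s.den) ≤ |(r : ℝ) - s| := by
  have hne : r - s ≠ 0 := sub_ne_zero.mpr hrs
  have h1 : ((r - s : ℚ) : ℝ) = ((r - s).num : ℝ) / ((r - s).den : ℝ) := by
    exact_mod_cast ((r - s).num_div_den).symm
  have hnum : (1 : ℝ) ≤ |((r - s).num : ℝ)| := by
    have : (r - s).num ≠ 0 := Rat.num_ne_zero.mpr hne
    exact_mod_cast Int.one_le_abs this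
  have hdenle : ((r - s).den : ℝ) ≤ (r.den : ℝ) * s.den := by
    have := Nat.le_of_dvd (Nat.mul_pos r.den_pos s.den_pos) (Rat.sub_den_dvd r s)
    exact_mod_cast this
  have hdenpos : (0 : ℝ) < (r - s).den := by exact_mod_cast (r - s).den_pos
  rw [show (r : ℝ) - s = ((r - s : ℚ) : ℝ) by push_cast; ring, h1, abs_div, abs_of_pos hdenpos]
  calc 1 / ((r.den : ℝ) * s.den) ≤ 1 / ((r - s).den : ℝ) := one_div_le_one_div_of_le hdenpos hdenle
    _ ≤ |((r - s).num : ℝ)| / ((r - s).den : ℝ) := div_le_div_of_nonneg_right hnum hdenpos.le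

set_option maxHeartbeats 800000 in
/-- **SEPARATION 3a: `T⋆` is NOT a covered tower** (g37's first-scale class). -/
theorem not_coveredTower_Tstar : ¬ Sep.CoveredTower Tstar := by
  rintro ⟨N₀, hN⟩
  -- the scale: ν := N₀ + 1, a := a_ν ≥ 8, X := 2^a + 1
  have hν1 : 1 ≤ N₀ + 1 := by omega
  set ν : ℕ := N₀ + 1 with hνdef
  set a : ℕ := aSeq ν with hadef
  have ha8 : 8 ≤ a := eight_le_aSeq hν1
  have hX : N₀ ≤ 2 ^ a + 1 := by
    have h1 := succ_le_aSeq ν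
    have h2 : a < 2 ^ a := Nat.lt_two_pow_self
    omega
  obtain ⟨r, hden, hlog, hclose⟩ := hN (2 ^ a + 1) hX
  set q : ℕ := r.den with hqdef
  have hq0 : 0 < q := r.den_pos
  have hq0R : (0 : ℝ) < q := by exact_mod_cast hq0
  have hqR : (2 : ℝ) ^ a + 1 ≤ q := by exact_mod_cast hden
  have h2a0 : (0 : ℝ) < (2 : ℝ) ^ a := by positivity
  have h2a_lt_q : (2 : ℝ) ^ a < q := by linarith
  -- (R1) log q ≤ 4 (a+1)^4
  have hXR : (((2 ^ a + 1 : ℕ) : ℝ)) = (2 : ℝ) ^ a + 1 := by push_cast; ring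
  have hlogX : Real.log (((2 ^ a + 1 : ℕ) : ℝ)) ≤ (a : ℝ) + 1 := by
    rw [hXR, Real.log_le_iff_le_exp (by positivity)]
    have he2 : (2 : ℝ) ≤ Real.exp 1 := by have := Real.exp_one_gt_d9; linarith
    calc (2 : ℝ) ^ a + 1 ≤ 2 ^ a + 2 ^ a := by linarith [one_le_pow₀ (one_le_two : (1:ℝ) ≤ 2) (n := a)]
      _ = 2 ^ (a + 1) := by ring
      _ ≤ Real.exp 1 ^ (a + 1) := pow_le_pow_left₀ (by norm_num) he2 _
      _ = Real.exp ((a : ℝ) + 1) := by rw [Real.exp_one_pow]; push_cast; ring_nf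
  have hlogX0 : 0 ≤ Real.log (((2 ^ a + 1 : ℕ) : ℝ)) := Real.log_nonneg (by rw [hXR]; linarith)
  have hlogq : Real.log q ≤ 4 * ((a : ℝ) + 1) ^ 4 :=
    hlog.trans (mul_le_mul_of_nonneg_left (pow_le_pow_left₀ hlogX0 hlogX 4) (by norm_num))
  -- (R3) 4 q² ≤ 2^{a_{ν+1}}
  have hkey : (8 : ℝ) * ((a : ℝ) + 1) ^ 4 + 2 ≤ ((3 ^ 2 ^ a : ℕ) : ℝ) := by
    exact_mod_cast key_nat ha8
  have h4q2 : 4 * (q : ℝ) ^ 2 ≤ (2 : ℝ) ^ aSeq (ν + 1) := by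
    have hq_le : (q : ℝ) ≤ Real.exp (4 * ((a : ℝ) + 1) ^ 4) :=
      (Real.log_le_iff_le_exp hq0R).mp hlogq
    have he2 : (4 : ℝ) ≤ Real.exp 2 := by
      have h := Real.add_one_le_exp (1 : ℝ)
      have : Real.exp 2 = Real.exp 1 * Real.exp 1 := by rw [← Real.exp_add]; norm_num
      nlinarith [Real.exp_pos (1 : ℝ)]
    calc 4 * (q : ℝ) ^ 2 ≤ Real.exp 2 * Real.exp (4 * ((a : ℝ) + 1) ^ 4) ^ 2 := by
          gcongr
      _ = Real.exp (8 * ((a : ℝ) + 1) ^ 4 + 2) := by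
          rw [← Real.exp_nat_mul, ← Real.exp_add]; push_cast; ring_nf
      _ ≤ (4 : ℝ) ^ (3 ^ 2 ^ a) := exp_le_four_pow hkey
      _ = (2 : ℝ) ^ (2 * 3 ^ 2 ^ a) := by rw [pow_mul]; norm_num
      _ ≤ (2 : ℝ) ^ aSeq (ν + 1) := pow_le_pow_right₀ one_le_two (two_mul_three_pow_le_aSeq_succ hν1)
  -- (R4) the dyadic truncation s = p_ν / 2^a and the tail
  set s : ℚ := Rat.divInt (pnum ν : ℤ) ((2 : ℤ) ^ a) with hsdef
  have hsR : ((s : ℚ) : ℝ) = (pnum ν : ℝ) / 2 ^ a := by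
    rw [hsdef, Rat.divInt_eq_div]; push_cast; rfl
  have htail_pos : 0 < Tstar - (s : ℝ) := by rw [hsR, hadef, Tstar_sub_partialSum]; exact tail_pos ν
  have htail_le : Tstar - (s : ℝ) ≤ 2 * ((2 : ℝ) ^ aSeq (ν + 1))⁻¹ := by
    rw [hsR, hadef, Tstar_sub_partialSum]; exact tail_le ν
  -- (R5) den s ≤ 2^a, hence r ≠ s
  have hsden : (s.den : ℝ) ≤ (2 : ℝ) ^ a := by
    have h1 : ((s.den : ℤ)) ≤ (2 : ℤ) ^ a := Int.le_of_dvd (by positivity) (Rat.den_dvd _ _)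
    exact_mod_cast h1
  have hrs : r ≠ s := by
    intro h
    have : (q : ℝ) ≤ (2 : ℝ) ^ a := by rw [hqdef, h]; exact hsden
    linarith
  -- (R7) |r − s| ≥ 1/(q·2^a) ≥ 1/q²
  have hsep : 1 / ((q : ℝ) * q) ≤ |(r : ℝ) - s| := by
    refine le_trans ?_ (one_div_le_abs_sub_rat hrs)
    rw [← hqdef]
    exact one_div_le_one_div_of_le (mul_pos hq0R (by exact_mod_cast s.den_pos))
      (mul_le_mul_of_nonneg_left (hsden.trans h2a_lt_q.le) hq0R.le)
  -- (R8) tail ≤ 1/(2q²), so |T⋆ − r| ≥ 1/(2q²)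
  have htail_small : Tstar - (s : ℝ) ≤ 1 / (2 * ((q : ℝ) * q)) := by
    refine htail_le.trans ?_
    rw [div_eq_mul_inv, one_mul]
    have hpos : (0 : ℝ) < 2 * ((q : ℝ) * q) := by positivity
    calc 2 * ((2 : ℝ) ^ aSeq (ν + 1))⁻¹ ≤ 2 * (4 * (q : ℝ) ^ 2)⁻¹ :=
          mul_le_mul_of_nonneg_left (inv_anti₀ (by positivity) h4q2) (by norm_num)
      _ = (2 * ((q : ℝ) * q))⁻¹ := by field_simp; ring
  have hlow : 1 / (2 * ((q : ℝ) * q)) ≤ |Tstar - r| := by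
    have e : Tstar - r = (Tstar - s) - ((r : ℝ) - s) := by ring
    have htri : |(r : ℝ) - s| - (Tstar - s) ≤ |Tstar - r| := by
      rw [e, abs_sub_comm (Tstar - s) ((r : ℝ) - s)]
      have := abs_sub_abs_le_abs_sub ((r : ℝ) - s) (Tstar - s)
      rw [abs_of_pos htail_pos] at this
      exact this
    have : 1 / ((q : ℝ) * q) - 1 / (2 * ((q : ℝ) * q)) = 1 / (2 * ((q : ℝ) * q)) := by
      field_simp; ring
    linarith
  -- (R9) exp(−log³ q) < 1/(2q²)
  have hL2 : 2 ≤ Real.log q := by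
    rw [Real.le_log_iff_exp_le hq0R]
    have he3 : Real.exp 1 < 3 := by have := Real.exp_one_lt_d9; linarith
    have : Real.exp 2 = Real.exp 1 * Real.exp 1 := by rw [← Real.exp_add]; norm_num
    have h256 : (256 : ℝ) ≤ (2 : ℝ) ^ a := by
      calc (256 : ℝ) = 2 ^ 8 := by norm_num
        _ ≤ 2 ^ a := pow_le_pow_right₀ one_le_two ha8
    nlinarith [Real.exp_pos (1 : ℝ)]
  have hsmall : Real.exp (-(Real.log q ^ 3)) < 1 / (2 * ((q : ℝ) * q)) := by
    have hpos : (0 : ℝ) < 2 * ((q : ℝ) * q) := by positivity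
    rw [one_div, ← Real.exp_log hpos, ← Real.exp_neg, Real.exp_lt_exp, neg_lt_neg_iff,
      Real.log_mul (by norm_num) (by positivity), Real.log_mul hq0R.ne' hq0R.ne']
    have hlog2 : Real.log 2 < 1 := by have := Real.log_two_lt_d9; linarith
    set L := Real.log q
    have h1 : 0 ≤ (L - 2) * (L + 2) * L :=
      mul_nonneg (mul_nonneg (sub_nonneg.mpr hL2) (by linarith)) (by linarith)
    have h2 : L ^ 3 - 4 * L = (L - 2) * (L + 2) * L := by ring
    linarith
  -- (R10)
  linarith [hlow, hclose, hsmall]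

/-- **SEPARATION 3: `z₄ ∉` g37's two-scale class** (its first scale `T⋆` is not a covered tower). -/
theorem not_inTwoScaleClass_zStar : ¬ Sep.InTwoScaleClass zStar := by
  rintro ⟨T, σ, β, hCT, -, -, -, -, hz⟩
  have h0 : (Tstar : ℂ) = (T : ℂ) := by
    have := congrFun hz 0
    simpa using this
  have hT : T = Tstar := (Complex.ofReal_injective h0).symm
  exact not_coveredTower_Tstar (hT ▸ hCT)

end Summit.Schanuel.Schanuel.Theorems.RootDecomp1ELWTransport

end
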